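import Literature.AlgebraicGeometry.Motives.PushforwardProjectionFormula
import HarnessLib

/-!
# `C(X × Z) ⇒ C(X)` and `C(Z)` for every Weil cohomology theory, without rational points
(Kahn 2020 Lemma 6.30 (2); Kleiman 1968 §1.3)

Let `W` be a Weil cohomology theory (the tree's `WeilCohomology k K`) and `X`, `Z` smooth projective
of dimensions `n`, `m`. The tree proves `C(X) ∧ C(Z) ⇒ C(X × Z)` (Kahn 2020 Lemma 6.30 (3),
`standardConjectureC_tensor`) and the converse *when the other factor has a `k`-point* (a section
of the projection makes `X` a retract of `X × Z`, `standardConjectureC_of_tensor_of_point`). This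
file removes the rational point: **`h(X)` is always a direct summand of `h(X × Z)` through algebraic
correspondences**, namely
`A = pr_X^* : H•(X) → H•(X × Z)` and `B = pr_{X*} ∘ (· ∪ pr_Z^* a) : H•(X × Z) → H•(X)` for a
rational algebraic zero-cycle class `a ∈ Aᵐ(Z)_ℚ` of degree `tr_Z a = 1`
(`exists_mem_ratAlgebraicClasses_trace_eq_one`): by the projection formula and base change,
`B (A x) = pr_{X*} (pr_X^* x ∪ pr_Z^* a) = tr_Z(a) · x = x` (`pushforward_fst_externalCup`). Both
are algebraic graded correspondences — `pr_X^*` by `isAlgebraicGradedOp_degreewise_pullback`,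
`pr_{X*}` in all degrees by `exists_isAlgebraicGradedOp_pushforward` (this lane's
`PushforwardProjectionFormula`), the cup product with a rational algebraic class by
`exists_isAlgebraicGradedOp_cup` (Kleiman 1968 §1.4, the correspondence `pr₁^* ζ ∪ Δ`), and
composites by `isAlgebraicGradedOp_comp_holds`. Hence Kahn's Lemma 6.30 (2) (direct summands,
the tree's `isAlgebraicOperator_id_of_retract`) gives:

* `isAlgebraicOperator_id_of_tensor_left/right` — `πⁱ_{X×Z}` algebraic ⇒ `πⁱ_X`, `πⁱ_Z` algebraic;
* `standardConjectureC_of_tensor_left/right`, `standardConjectureC_tensor_iff` —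
  **`C(X × Z) ⇔ C(X) ∧ C(Z)`** unconditionally (the tree's `standardConjectureC_tensor_iff_of_points`
  assumed `k`-points on both factors).

Also: `pushforward_fst_pullback_snd` (`pr_{X*} pr_Z^* a = tr_Z(a) · 1`, base change for the
projections) and `exists_algebraic_retraction_pullback_fst` (an algebraic left inverse of `pr_X^*`).
Theorems only; no new definitions, no named facts.

## References

* [Kahn2020] B. Kahn, *Zeta and L-functions of varieties and motives*, LMS Lecture Note Series 462
  (2020), §3.5.1 (projection formula), §6.9 Lemma 6.30 (2), (3).
* [Kleiman1968AlgebraicCycles] S. Kleiman, *Algebraic cycles and the Weil conjectures*, in: Dix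
  exposés sur la cohomologie des schémas (1968), §1.3, §1.4.
-/

universe u v

open CategoryTheory AlgebraicGeometry MonoidalCategory CartesianMonoidalCategory

noncomputable section

namespace Literature.AlgebraicGeometry.Motives

/-- Composition with a graded operator shifting degrees by `s` on the right: if `T i m = 0` unless
`m = i + s`, then `(S ∘ T)ᵢⱼ = S_{i+s, j} ∘ T_{i, i+s}` (the sum over the middle degree has one
term; Kleiman 1968 §1.4, componentwise composition of the operators of the theory).
[cite: Kleiman1968AlgebraicCycles, §1.4] -/
theorem PreWeilCohomology.GradedOp.comp_apply_of_shift {k : Type u} [Field k] {K : Type v}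
    [Field K] {W : PreWeilCohomology k K} {X Y Z : SchemeOver k} (S : W.GradedOp Y Z)
    (T : W.GradedOp X Y) (s : ℕ) (hT : ∀ i m : ℕ, m ≠ i + s → T i m = 0) (i j : ℕ) :
    S.comp T i j = (S (i + s) j).comp (T i (i + s)) := by
  refine finsum_eq_single _ (i + s) fun m hm ↦ ?_
  rw [hT i m hm, LinearMap.comp_zero]

namespace WeilCohomology

variable {k : Type u} [Field k] {K : Type v} [Field K] [CharZero K] (W : WeilCohomology k K)

/-! ## The cup product with a rational algebraic class is an algebraic graded correspondence -/

section Cup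

variable {n : ℕ} {Y : SchemeOver k}

/-- **`(· ∪ ζ)` is induced by `pr₁* ζ ∪ Δ`** (Kleiman 1968 §1.4; the tree's
`isInducedBy_lefschetzPow` is the case `ζ = ηʳ`): if `Δ ∈ H^{2n}(Y × Y)` induces the identity of
every `Hʲ(Y)`, then for `i + 2r = j` the operator `(· ∪ ζ) : Hⁱ(Y) → Hʲ(Y)` is induced by
`pr₁* ζ ∪ Δ ∈ H^{2(r+n)}(Y × Y)` (`map_cup`, `cup_assoc`). [cite: Kleiman1968AlgebraicCycles, §1.4] -/
theorem isInducedBy_cup (hY : IsSmoothProjective n Y) {r : ℕ} (ζ : W.obj Y (2 * r))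
    {Δ : W.obj (Y ⊗ Y) (2 * n)}
    (hΔ : ∀ (i j' : ℕ) (hj : i + j' = 2 * n),
      W.IsInducedBy n n Δ (LinearMap.id : W.obj Y i →ₗ[K] W.obj Y i) hj
        (show i + 2 * n + j' = 2 * (n + n) by omega))
    {i j j' c : ℕ} (h : i + 2 * r = j) (hc : 2 * r + 2 * n = 2 * c) (hj : j + j' = 2 * n)
    (hm : i + 2 * c + j' = 2 * (n + n)) :
    W.IsInducedBy n n (W.cup hc (W.pullback (fst Y Y) (2 * r) ζ) Δ) ((W.cup h).flip ζ) hj hm := by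
  have hYY := IsSmoothProjective.tensor_holds hY hY
  intro x y
  have hid := hΔ j j' hj (W.cup h x ζ) y
  rw [LinearMap.id_apply] at hid
  rw [LinearMap.flip_apply, hid]
  change W.trace (Y ⊗ Y) (n + n) (W.cup _ (W.cup rfl
      (W.pullback (fst Y Y) j (W.cup h x ζ)) Δ) (W.pullback (snd Y Y) j' y)) = _
  rw [W.map_cup hYY hY (fst Y Y) h x ζ,
    W.cup_assoc hYY h hc rfl (show i + 2 * c = j + 2 * n by omega),
    W.cup_cup_congr (show i + 2 * c = j + 2 * n by omega) rfl _ hm]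

/-- **The cup product with a rational algebraic class is an algebraic graded correspondence**
(Kleiman 1968 §1.4: `(· ∪ ζ)` is induced by the algebraic cycle `Δ₊ ζ = pr₁* ζ · Δ`; the tree's
`exists_isAlgebraicGradedOp_lefschetzPow` is the case `ζ = ηʳ`): for `Y` smooth projective of
dimension `n` and `ζ ∈ Aʳ(Y)_ℚ` there is a graded operator with components `(· ∪ ζ) : Hᵃ(Y) →
Hᵇ(Y)` for `a + 2r = b`, `0` otherwise, induced by the rational algebraic class `pr₁* ζ ∪ Δ`
(`Δ ∈ Aⁿ(Y × Y)_ℚ` inducing the identity, axiom `exists_isInducedBy_id`).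
[cite: Kleiman1968AlgebraicCycles, §1.4] -/
theorem exists_isAlgebraicGradedOp_cup (hY : IsSmoothProjective n Y) {r : ℕ} {ζ : W.obj Y (2 * r)}
    (hζ : ζ ∈ W.ratAlgebraicClasses Y r) :
    ∃ T : W.GradedOp Y Y, (∀ ⦃a b : ℕ⦄ (h : a + 2 * r = b), T a b = (W.cup h).flip ζ) ∧
      (∀ ⦃a b : ℕ⦄, ¬ a + 2 * r = b → T a b = 0) ∧ W.IsAlgebraicGradedOp n n T := by
  have hYY := IsSmoothProjective.tensor_holds hY hY
  obtain ⟨Δ, hΔmem, hΔ⟩ := W.exists_isInducedBy_id hY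
  refine ⟨fun a b ↦ if h : a + 2 * r = b then (W.cup h).flip ζ else 0,
    fun a b h ↦ dif_pos h, fun a b h ↦ dif_neg h, ?_⟩
  have hmem : ∀ c : ℕ, (if h : 2 * r + 2 * n = 2 * c then
      W.cup h (W.pullback (fst Y Y) (2 * r) ζ) Δ else 0) ∈ W.ratAlgebraicClasses (Y ⊗ Y) c := by
    intro c
    split_ifs with h
    · exact W.cup_mem_ratAlgebraicClasses hYY (show r + n = c by omega) _ _
        (W.pullback_ratAlgebraicClasses_le hYY hY (fst Y Y) r ⟨_, hζ, rfl⟩) hΔmem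
    · exact zero_mem _
  refine ⟨fun c ↦ ⟨_, hmem c⟩, ?_, ?_⟩
  · intro i j c j' hj hm hc
    dsimp only
    by_cases h : i + 2 * r = j
    · have hc' : 2 * r + 2 * n = 2 * c := by omega
      rw [dif_pos h, dif_pos hc']
      exact W.isInducedBy_cup hY ζ hΔ h hc' hj hm
    · have hc' : ¬ 2 * r + 2 * n = 2 * c := by omega
      rw [dif_neg h, dif_neg hc']
      intro x y
      simp
  · intro i j hne
    exact dif_neg fun h ↦ hne ⟨n + r, by omega⟩

end Cup

/-! ## Base change for the projections and the transfer `pr_{X*} (· ∪ pr_Z^* a)` -/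

section Transfer

variable {n m : ℕ} {X Z : SchemeOver k}

/-- **Base change for the two projections**: `pr_{X*} (pr_Z^* a) = tr_Z(a) · 1_X` for a top-degree
class `a ∈ H^{2m}(Z)` (pair with `ω ∈ H^{2n}(X)`: `tr_X (pr_{X*} pr_Z^* a ∪ ω) =
tr_{X×Z} (pr_Z^* a ∪ pr_X^* ω) = tr_X ω · tr_Z a` by the adjunction `trace_cup_pushforward` and
the multiplicativity of the trace, axiom (B); Kahn 2020 §3.5.1 with `Tr_Z = (p_Z)_*`).
[cite: Kahn2020, §3.5.1] [cite: Kleiman1968AlgebraicCycles, §1.2 (B)] -/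
theorem pushforward_fst_pullback_snd (hX : IsSmoothProjective n X) (hZ : IsSmoothProjective m Z)
    (a : W.obj Z (2 * m)) (he : 2 * m + 2 * n = 2 * (n + m)) (hd : 0 + 2 * n = 2 * n) :
    W.pushforward (N := n + m) hX (fst X Z) he hd (W.pullback (snd X Z) (2 * m) a) =
      W.trace Z m a • W.one X := by
  have hXZ := IsSmoothProjective.tensor_holds hX hZ
  refine (W.pdEquiv hX hd).injective (LinearMap.ext fun ω ↦ ?_)
  rw [W.pdEquiv_apply, W.pdEquiv_apply, W.trace_cup_pushforward, LinearMap.map_smul₂, map_smul,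
    W.one_cup hX hd, smul_eq_mul,
    W.cup_comm_of_even hXZ he (show 2 * n + 2 * m = 2 * (n + m) by omega) (Or.inl ⟨m, two_mul m⟩),
    ← W.externalCup_apply, W.trace_externalCup' hX hZ, mul_comm]

/-- **The transfer formula** `pr_{X*} (pr_X^* x ∪ pr_Z^* a) = tr_Z(a) · x` for `x ∈ Hⁱ(X)` and a
top-degree class `a ∈ H^{2m}(Z)`: the projection formula `pr_{X*} (pr_X^* x ∪ α) = x ∪ pr_{X*} α`
(Kahn 2020 §3.5.1, `pushforward_pullback_cup`) and base change `pushforward_fst_pullback_snd`.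
Degrees: `i + i' = 2n`, `i + 2m + i' = 2(n + m)`. [cite: Kahn2020, §3.5.1 (projection formula)] -/
theorem pushforward_fst_externalCup (hX : IsSmoothProjective n X) (hZ : IsSmoothProjective m Z)
    {i i' : ℕ} (hi : i + i' = 2 * n) (x : W.obj X i) (a : W.obj Z (2 * m))
    (he : i + 2 * m + i' = 2 * (n + m)) :
    W.pushforward (N := n + m) hX (fst X Z) he hi (W.externalCup X Z rfl x a) =
      W.trace Z m a • x := by
  have hXZ := IsSmoothProjective.tensor_holds hX hZ
  rw [W.externalCup_apply,
    W.pushforward_pullback_cup hXZ hX (fst X Z) rfl he hi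
      (show 2 * m + 2 * n = 2 * (n + m) by omega) (Nat.zero_add _) (Nat.add_zero i) x
      (W.pullback (snd X Z) (2 * m) a),
    W.pushforward_fst_pullback_snd hX hZ a, LinearMap.map_smul, W.cup_one hX (Nat.add_zero i)]

/-- **`pr_X^*` has an algebraic left inverse** (no rational point on `Z` needed): there is a
degree-preserving algebraic graded correspondence `B : H•(X × Z) → H•(X)` with
`Bᵢ ∘ pr_X^* = id` on every `Hⁱ(X)` — namely `B = pr_{X*} ∘ (· ∪ pr_Z^* a)` for `a ∈ Aᵐ(Z)_ℚ` with
`tr_Z a = 1` (`exists_mem_ratAlgebraicClasses_trace_eq_one`), algebraic as a composite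
(`isAlgebraicGradedOp_comp_holds`) of `exists_isAlgebraicGradedOp_cup` and
`exists_isAlgebraicGradedOp_pushforward`, and a left inverse by `pushforward_fst_externalCup`. So
`h(X)` is a direct summand of `h(X × Z)` in homological correspondences (Kahn 2020 Lemma 6.30 (2);
Kleiman 1968 §1.3). [cite: Kahn2020, §6.9 Lemma 6.30 (2)] [cite: Kleiman1968AlgebraicCycles, §1.3] -/
theorem exists_algebraic_retraction_pullback_fst (hX : IsSmoothProjective n X)
    (hZ : IsSmoothProjective m Z) :
    ∃ B : W.GradedOp (X ⊗ Z) X, W.IsAlgebraicGradedOp (n + m) n B ∧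
      (∀ i j : ℕ, i ≠ j → B i j = 0) ∧
      ∀ i : ℕ, B i i ∘ₗ W.pullback (fst X Z) i = LinearMap.id := by
  have hXZ := IsSmoothProjective.tensor_holds hX hZ
  obtain ⟨a, ha, htr⟩ := W.exists_mem_ratAlgebraicClasses_trace_eq_one hZ
  have hζ : W.pullback (snd X Z) (2 * m) a ∈ W.ratAlgebraicClasses (X ⊗ Z) m :=
    W.pullback_ratAlgebraicClasses_le hXZ hZ (snd X Z) m ⟨a, ha, rfl⟩
  obtain ⟨C, hC, hC0, hCalg⟩ := W.exists_isAlgebraicGradedOp_cup hXZ hζ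
  obtain ⟨P, hPalg, hP, hP0⟩ := W.exists_isAlgebraicGradedOp_pushforward hXZ hX (fst X Z)
  have hCs : ∀ i l : ℕ, l ≠ i + 2 * m → C i l = 0 := fun i l hl ↦ hC0 fun h ↦ hl h.symm
  refine ⟨P.comp C, W.isAlgebraicGradedOp_comp_holds hXZ hXZ hX hPalg hCalg, fun i j hij ↦ ?_,
    fun i ↦ ?_⟩
  · rw [PreWeilCohomology.GradedOp.comp_apply_of_shift P C (2 * m) hCs i j,
      hP0 (i + 2 * m) j (fun h ↦ hij (by obtain ⟨h1, -⟩ := h; omega)), LinearMap.zero_comp]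
  · rw [PreWeilCohomology.GradedOp.comp_apply_of_shift P C (2 * m) hCs i i]
    by_cases hi : i ≤ 2 * n
    · rw [hP (i + 2 * m) i (2 * n - i) (by omega) (by omega), hC rfl]
      refine LinearMap.ext fun x ↦ ?_
      rw [LinearMap.comp_apply, LinearMap.comp_apply, LinearMap.flip_apply, ← W.externalCup_apply,
        W.pushforward_fst_externalCup hX hZ (by omega) x a, htr, one_smul, LinearMap.id_apply]
    · haveI := W.subsingleton_obj hX (i := i) (by omega)
      exact LinearMap.ext fun x ↦ Subsingleton.elim _ _

end Transfer

/-! ## `C(X × Z) ⇒ C(X)`, `C(Z)` -/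

section Descent

variable {n m : ℕ} {X Z : SchemeOver k}

/-- **`πⁱ_{X×Z}` algebraic ⇒ `πⁱ_X` algebraic**, for every Weil cohomology theory and all smooth
projective `X`, `Z` (no rational point on `Z` required): `h(X)` is a direct summand of `h(X × Z)`
through `pr_X^*` and its algebraic left inverse `pr_{X*} (· ∪ pr_Z^* a)`
(`exists_algebraic_retraction_pullback_fst`), and Kahn's Lemma 6.30 (2) applies
(`isAlgebraicOperator_id_of_retract`). [cite: Kahn2020, §6.9 Lemma 6.30 (2)] -/
theorem isAlgebraicOperator_id_of_tensor_left (hX : IsSmoothProjective n X)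
    (hZ : IsSmoothProjective m Z) {i : ℕ}
    (hi : W.IsAlgebraicOperator (n + m) (n + m)
      (LinearMap.id : W.obj (X ⊗ Z) i →ₗ[K] W.obj (X ⊗ Z) i)) :
    W.IsAlgebraicOperator n n (LinearMap.id : W.obj X i →ₗ[K] W.obj X i) := by
  have hXZ := IsSmoothProjective.tensor_holds hX hZ
  obtain ⟨B, hBalg, hBd, hBA⟩ := W.exists_algebraic_retraction_pullback_fst hX hZ
  refine W.isAlgebraicOperator_id_of_retract hX hXZ
    (A := fun a b ↦ PreWeilCohomology.GradedOp.ofLinearMap (W.pullback (fst X Z) a) a b) (B := B)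
    (W.isAlgebraicGradedOp_degreewise_pullback hXZ hX (fst X Z)) hBalg
    (fun a b hab ↦ PreWeilCohomology.GradedOp.degreewise_apply_of_ne _ hab) hBd ?_ hi
  simpa only [PreWeilCohomology.GradedOp.ofLinearMap_apply_same] using hBA i

/-- **`πⁱ_{X×Z}` algebraic ⇒ `πⁱ_Z` algebraic** (the second factor; via the braiding
`Z × X ≅ X × Z`, `isAlgebraicOperator_id_of_section`, and `isAlgebraicOperator_id_of_tensor_left`).
[cite: Kahn2020, §6.9 Lemma 6.30 (2)] -/
theorem isAlgebraicOperator_id_of_tensor_right (hX : IsSmoothProjective n X)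
    (hZ : IsSmoothProjective m Z) {i : ℕ}
    (hi : W.IsAlgebraicOperator (n + m) (n + m)
      (LinearMap.id : W.obj (X ⊗ Z) i →ₗ[K] W.obj (X ⊗ Z) i)) :
    W.IsAlgebraicOperator m m (LinearMap.id : W.obj Z i →ₗ[K] W.obj Z i) := by
  have hXZ := IsSmoothProjective.tensor_holds hX hZ
  have hZX := IsSmoothProjective.tensor_holds hZ hX
  exact W.isAlgebraicOperator_id_of_tensor_left hZ hX
    (W.isAlgebraicOperator_id_of_section hZX hXZ (β_ Z X).hom (β_ Z X).inv (β_ Z X).hom_inv_id hi)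

/-- **`C(X × Z) ⇒ C(X)`** for every Weil cohomology theory and all smooth projective `X`, `Z`
(Kahn 2020 Lemma 6.30 (2): `C` passes to direct summands; `h(X)` is a direct summand of `h(X × Z)`,
`exists_algebraic_retraction_pullback_fst`). The tree's `standardConjectureC_of_tensor_of_point`
assumed a `k`-point on `Z`. [cite: Kahn2020, §6.9 Lemma 6.30 (2)] -/
theorem standardConjectureC_of_tensor_left (hX : IsSmoothProjective n X) (hZ : IsSmoothProjective m Z)
    (hC : W.StandardConjectureC (n + m) (X ⊗ Z)) : W.StandardConjectureC n X :=
  W.standardConjectureC_iff.mpr fun _ ↦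
    W.isAlgebraicOperator_id_of_tensor_left hX hZ (W.standardConjectureC_iff.mp hC _)

/-- **`C(X × Z) ⇒ C(Z)`** (second factor). [cite: Kahn2020, §6.9 Lemma 6.30 (2)] -/
theorem standardConjectureC_of_tensor_right (hX : IsSmoothProjective n X) (hZ : IsSmoothProjective m Z)
    (hC : W.StandardConjectureC (n + m) (X ⊗ Z)) : W.StandardConjectureC m Z :=
  W.standardConjectureC_iff.mpr fun _ ↦
    W.isAlgebraicOperator_id_of_tensor_right hX hZ (W.standardConjectureC_iff.mp hC _)

/-- **`C(X × Z) ⇔ C(X) ∧ C(Z)`** for every Weil cohomology theory and all smooth projective `X`, `Z`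
(Kahn 2020 Lemma 6.30 (2) and (3); "⇐" is the tree's `standardConjectureC_tensor`). Unconditional
form of the tree's `standardConjectureC_tensor_iff_of_points`. [cite: Kahn2020, §6.9 Lemma 6.30 (2)–(3)] -/
theorem standardConjectureC_tensor_iff (hX : IsSmoothProjective n X) (hZ : IsSmoothProjective m Z) :
    W.StandardConjectureC (n + m) (X ⊗ Z) ↔ W.StandardConjectureC n X ∧ W.StandardConjectureC m Z :=
  ⟨fun hC ↦ ⟨W.standardConjectureC_of_tensor_left hX hZ hC, W.standardConjectureC_of_tensor_right hX hZ hC⟩,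
    fun h ↦ W.standardConjectureC_tensor hX hZ h.1 h.2⟩

/-- **`C(X × X) ⇔ C(X)`**. [cite: Kahn2020, §6.9 Lemma 6.30 (2)–(3)] -/
theorem standardConjectureC_tensor_self_iff (hX : IsSmoothProjective n X) :
    W.StandardConjectureC (n + n) (X ⊗ X) ↔ W.StandardConjectureC n X :=
  (W.standardConjectureC_tensor_iff hX hX).trans (and_self_iff)

end Descent

end WeilCohomology

end Literature.AlgebraicGeometry.Motives

end
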